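import Summits.NavierStokesRegularity.NavierStokesRegularity.Theses.PlaneEnergyCeiling

/-!
# Route PlaneEnergyCeiling · `Assembly` (stmt-NavierStokesRegularity-17948) — proved

The assembly item mirrors the route's certified deciding theorem
`Theses.PlaneEnergyCeiling.closes`: `PlanarEnergyAPriori → PlanarEnergyLiouville →
PlanarEnergyZoomA → NavierStokesRegularity` (second layer by contradiction inside `closes`, then
the Clay-(A)-form argument datum by datum). One application of `closes`.

References: Fefferman 2000 (Clay statement (A)); KNSS 2009. [Fefferman2000] [KNSS2009]
-/

-- single-conjunct summit: `Summit.<Summit>.<Problem>` repeats the name by the D-0017 layout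
set_option linter.dupNamespace false

namespace Summit.NavierStokesRegularity.NavierStokesRegularity.Theorems

open Summit.NavierStokesRegularity.NavierStokesRegularity.Theses.PlaneEnergyCeiling in
/-- **Assembly of the route `PlaneEnergyCeiling` (stmt-NavierStokesRegularity-17948), proved**:
the planar energy ceiling, Liouville in the planar-energy class and the (A)-form velocity-record
zoom imply the Clay Millennium statement `NavierStokesRegularity` — literally the deciding
theorem `closes`. -/
theorem planeEnergyCeiling_assembly_proof :
    Summit.NavierStokesRegularity.NavierStokesRegularity.Theses.PlaneEnergyCeiling.Assembly :=
  fun h₁ h₃ h₅ => closes h₁ h₃ h₅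

end Summit.NavierStokesRegularity.NavierStokesRegularity.Theorems
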